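import Summits.QuantumFields.BalabanUV.T4Continuum.Support.NE7CriticalOrbitUniqueGeneric
import HarnessLib

/-!
# NE7MinimalOrbitClassStable — [Balaban1985Variational] THEOREM 1's TWO-RADII STRUCTURE «a minimal orbit in the space 𝔘_k(B₃ε₁) … is a unique critical orbit in the space (6) if
# B₃ε₁ ≤ ε₀ ≤ a₀»: THE MINIMAL (= CRITICAL) ORBIT DOES NOT DEPEND ON THE CLASS RADIUS — for every `U(n)`, every `L ≥ 2`, `d = 4`, all `0 < ε′ ≤ ε ≤ ε₀(n, L)`, over the small data and
# at every level, the constrained minimisers of `sfClass 4 L N ε` and of `sfClass 4 L N ε′` over the same datum are THE SAME configurations; consequently every minimiser of the big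
# class `sfClass ε` has plaquettes within `(ε′∕4)∕M²` of `1` — the minimal orbit found in the small space is the unique critical orbit of every bigger space up to the absolute radius `ε₀`

Cell `pub-balaban`, rung (B)+1 sub-cell t4, lineage `b2b-balaban-t4-ne7-p1` (CRUX PROVER NE7 #1 = OWNER of BINDER row NE7), generation 113.  Memo
`t4/b2b-balaban-t4-ne7-p1-g113/ROAD-G113.md` §4.  Over gen 113's ✓ p818723 `NE7CriticalOrbitUniqueGeneric` (critical ⇒ minimal and a gauge copy of `U♯`; minimal ⇒ critical), gen 109's
✓ p810221 `NE7HintUnconditionalGeneric.hint_small_data_generic` ((8)∃ interior) and ✓ p810372 `NE7AllMinimisersSmallGeneric.all_minimisers_small_generic` ((8)∀: relative radius `ε∕4`).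
THE ARGUMENT.  Tangent-criticality (stationarity along the kernel of the differential of the averaging map) does not see the class radius.  (⇒) A minimiser `U` of the `ε`-class is
critical (p818723 (i)); the interior minimiser `U′` of the `ε′`-class ((8)∃ at `ε′`) is critical and `ε`-admissible; by p818723 (ii) at radius `ε` both are gauge copies of one `U♯`, so
`U = U′^{w}` with `w` unitary periodic — `U` lies in the `ε′`-class (plaquette norms are gauge invariant) and has the `ε′`-minimal action.  (⇐) A minimiser of the `ε′`-class is interior
there ((8)∀ at `ε′`), hence critical, hence (p818723 (ii) at radius `ε`) a minimiser of the `ε`-class.  Level `0`: both admissible sets are the datum alone.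
WHAT ([folklore]; 0 def, 0 sorry; `d = 4`, every `U(n)`, every `L ≥ 2`).  **`minimal_orbit_class_stable`**: `∃ ε₀ > 0, ∀ ε ε′, 0 < ε′ ≤ ε ≤ ε₀ → ∀ N ≥ 1, ∃ δ_V > 0, ∀ V (unitary, N-periodic,
SmallField V δ_V), ∀ k U, (IsMinimiser 4 (sfClass 4 L N ε) L N k V U ↔ IsMinimiser 4 (sfClass 4 L N ε′) L N k V U) ∧ (IsMinimiser 4 (sfClass 4 L N ε) L N k V U → SmallField U
((ε′∕4)∕(L^k)²))`.
DICTIONARY WITH PRINT (Thm 1 p. 279): print's small space `𝔘_k({Ω_j}, B₃ε₁) ∩ 𝔅_k(𝔅_k, V)` = our `admissible (sfClass 4 L N ε′) L k V`, print's space (6) with radius `ε₀ ∈ [B₃ε₁, a₀]` = our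
`admissible (sfClass 4 L N ε) L k V`, `ε ∈ [ε′, ε₀(n, L)]`; the data radius `δ_V(n, L, ε, ε′, N)` is existential here (print: `ε₁`, with `B₃ε₁` LINEAR in it — not claimed).
HONEST FRAMING (page 1): composition of landed kernel theorems of this lineage (gens 90–113) and [B7]∕[B8]∕[B11] AS TYPED; nothing of Bałaban's asserted as an axiom and NOT his method;
finite 4-torus, small data, constants existential; NOT NE7 as a spine node (dagwriter∕referees' call), NOT NE3; spine 0∕9; NOT infinite volume, NOT mass gap, NOT BetaPertH, NOT Clay
(continuum YM on T⁴ ⇐ BetaPertH ∧ nine spine estimates).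
-/

set_option autoImplicit false

open scoped BigOperators Matrix Matrix.Norms.L2Operator
open NormedSpace Finset Set

namespace Summit.QuantumFields.BalabanUV.T4Continuum.NE7MinimalOrbitClassStable

open Literature.MathematicalPhysics.QuantumFieldTheory.Balaban1983to89
open B7Prop1Explicit B7Prop2Explicit
open T4AveragingDeficitWall (IsUnitaryCfg IsSkewDir SmallField)
open T4AveragingDeficitWallBoundary (IsPeriodicCfg periodBox)
open AveragingDeficitPeriodicCounting (IsPeriodicDir)
open AveragingDeficitMultiLevelPrep (LevelSmall TangentIter)
open MinimalActionLevels (perWin levelAction)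
open MinimalActionSandwich (IsMinimiser admissible)
open MinimalActionRate (sfClass)
open NE3HessForm (dAction)
open NE3EnergyShapes (IsUnitarySite IsPeriodicSite)
open NE7OpenOfMinimisation (tanCritical_of_isMinimiser)
open NE7HintUnconditionalGeneric (hint_small_data_generic)
open NE7EnergyClassPoincareGeneric (classPackage)
open NE7EtaMinimiserGaugeCovariance (levelAction_gaugeAct isUnitarySite_inv)
open BlockAverageCurrent (smallField_gaugeAct)
open NE7AllMinimisersSmallGeneric (admissible_mono_radius eq_of_admissible_zero all_minimisers_small_generic)
open AveragingDeficitKDatum (gaugeAct_inv_gaugeAct)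
open NE7CriticalOrbitUniqueGeneric (critical_orbit_unique_generic tanCritical_of_isMinimiser_smallData)

noncomputable section

variable {n : Type} [Fintype n] [DecidableEq n]

/-- **THE MINIMAL ORBIT DOES NOT DEPEND ON THE CLASS RADIUS, EVERY `U(n)`, EVERY `L ≥ 2`, `d = 4`** (statement and argument in the file header): for `0 < ε′ ≤ ε ≤ ε₀`, over the small data
and at every level, the minimisers of `sfClass ε` and of `sfClass ε′` over the same datum coincide, and every minimiser of `sfClass ε` has plaquettes within `(ε′∕4)∕M²` of `1`. [folklore] -/
theorem minimal_orbit_class_stable [Nonempty n] {L : ℕ} (hL : 2 ≤ L) :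
    ∃ ε₀ : ℝ, 0 < ε₀ ∧ ∀ ε ε' : ℝ, 0 < ε' → ε' ≤ ε → ε ≤ ε₀ → ∀ (N : ℕ) [NeZero N], 1 ≤ N →
      ∃ δV : ℝ, 0 < δV ∧
        ∀ V ∈ {V : Site 4 → Fin 4 → (Matrix n n ℂ)ˣ | IsUnitaryCfg V ∧ IsPeriodicCfg V (N : ℤ) ∧ SmallField V δV},
        ∀ (k : ℕ) (U : Site 4 → Fin 4 → (Matrix n n ℂ)ˣ),
          (IsMinimiser 4 (sfClass 4 L N ε) L N k V U ↔ IsMinimiser 4 (sfClass 4 L N ε') L N k V U) ∧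
          (IsMinimiser 4 (sfClass 4 L N ε) L N k V U → SmallField U ((ε' / 4) / ((L : ℝ) ^ k) ^ 2)) := by
  haveI : NeZero L := ⟨by omega⟩
  have hL1 : 1 ≤ L := by omega
  have hL0 : (0 : ℝ) < L := by exact_mod_cast (show 0 < L by omega)
  obtain ⟨ε₁, hε₁, H1⟩ := hint_small_data_generic (n := n) hL
  obtain ⟨ε₂, hε₂, H2⟩ := critical_orbit_unique_generic (n := n) hL
  obtain ⟨ε₄, hε₄, H4⟩ := tanCritical_of_isMinimiser_smallData (n := n) hL
  obtain ⟨ε₅, hε₅, H5⟩ := all_minimisers_small_generic (n := n) hL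
  obtain ⟨θ₀, CF, CE, hθ₀, -, -, -, -, -, hlsP, -, -⟩ := classPackage (n := n) (d := 4) (by norm_num) hL
  refine ⟨min ε₁ (min ε₂ (min ε₄ (min ε₅ θ₀))), lt_min hε₁ (lt_min hε₂ (lt_min hε₄ (lt_min hε₅ hθ₀))), ?_⟩
  intro ε ε' hε' hε'ε hεle N _ hN
  have hε : 0 < ε := lt_of_lt_of_le hε' hε'ε
  have hεε₁ : ε ≤ ε₁ := hεle.trans (min_le_left _ _)
  have hε'ε₁ : ε' ≤ ε₁ := hε'ε.trans hεε₁
  have hεε₂ : ε ≤ ε₂ := hεle.trans ((min_le_right _ _).trans (min_le_left _ _))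
  have hεε₄ : ε ≤ ε₄ := hεle.trans ((min_le_right _ _).trans ((min_le_right _ _).trans (min_le_left _ _)))
  have hε'ε₅ : ε' ≤ ε₅ := hε'ε.trans (hεle.trans ((min_le_right _ _).trans ((min_le_right _ _).trans ((min_le_right _ _).trans (min_le_left _ _)))))
  have hε'θ₀ : ε' ≤ θ₀ := hε'ε.trans (hεle.trans ((min_le_right _ _).trans ((min_le_right _ _).trans ((min_le_right _ _).trans (min_le_right _ _)))))
  have hls' : ∀ j : ℕ, LevelSmall 4 L j (ε' / ((L : ℝ) ^ (j + 1)) ^ 2) := hlsP hε'.le hε'θ₀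
  -- data radii: (8)∃ at `ε` and at `ε′`, p818723 (ii) and (i) at `ε`, (8)∀ at `ε′`
  obtain ⟨δa, hδa, Ka⟩ := H1 ε hε hεε₁ N hN
  obtain ⟨δa', hδa', Ka'⟩ := H1 ε' hε' hε'ε₁ N hN
  obtain ⟨δb, hδb, Kb⟩ := H2 ε hε hεε₂ N hN
  obtain ⟨δc, hδc, Kc⟩ := H4 ε hε hεε₄ N hN
  obtain ⟨δd, hδd, Kd⟩ := H5 ε' hε' hε'ε₅ N hN
  refine ⟨min δa (min δa' (min δb (min δc δd))), lt_min hδa (lt_min hδa' (lt_min hδb (lt_min hδc hδd))), ?_⟩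
  intro V hV k U
  obtain ⟨hVu, hVP, hVδ⟩ := hV
  have hVa : V ∈ {V : Site 4 → Fin 4 → (Matrix n n ℂ)ˣ | IsUnitaryCfg V ∧ IsPeriodicCfg V (N : ℤ) ∧ SmallField V δa} :=
    ⟨hVu, hVP, MinimalActionRate.SmallField.mono hVδ (min_le_left _ _)⟩
  have hVa' : V ∈ {V : Site 4 → Fin 4 → (Matrix n n ℂ)ˣ | IsUnitaryCfg V ∧ IsPeriodicCfg V (N : ℤ) ∧ SmallField V δa'} :=
    ⟨hVu, hVP, MinimalActionRate.SmallField.mono hVδ ((min_le_right _ _).trans (min_le_left _ _))⟩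
  have hVb : V ∈ {V : Site 4 → Fin 4 → (Matrix n n ℂ)ˣ | IsUnitaryCfg V ∧ IsPeriodicCfg V (N : ℤ) ∧ SmallField V δb} :=
    ⟨hVu, hVP, MinimalActionRate.SmallField.mono hVδ ((min_le_right _ _).trans ((min_le_right _ _).trans (min_le_left _ _)))⟩
  have hVc : V ∈ {V : Site 4 → Fin 4 → (Matrix n n ℂ)ˣ | IsUnitaryCfg V ∧ IsPeriodicCfg V (N : ℤ) ∧ SmallField V δc} :=
    ⟨hVu, hVP, MinimalActionRate.SmallField.mono hVδ ((min_le_right _ _).trans ((min_le_right _ _).trans ((min_le_right _ _).trans (min_le_left _ _))))⟩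
  have hVd : V ∈ {V : Site 4 → Fin 4 → (Matrix n n ℂ)ˣ | IsUnitaryCfg V ∧ IsPeriodicCfg V (N : ℤ) ∧ SmallField V δd} :=
    ⟨hVu, hVP, MinimalActionRate.SmallField.mono hVδ ((min_le_right _ _).trans ((min_le_right _ _).trans ((min_le_right _ _).trans (min_le_right _ _))))⟩
  -- the equivalence
  have hiff : IsMinimiser 4 (sfClass 4 L N ε) L N k V U ↔ IsMinimiser 4 (sfClass 4 L N ε') L N k V U := by
    cases k with
    | zero =>
        -- level 0: both admissible sets are the datum alone
        obtain ⟨U₀, hU₀, -⟩ := Ka V hVa 0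
        obtain ⟨U₀', hU₀', -⟩ := Ka' V hVa' 0
        constructor
        · intro hU
          have h1 : U = U₀' := by rw [eq_of_admissible_zero hU.mem, eq_of_admissible_zero hU₀'.mem]
          rw [h1]; exact hU₀'
        · intro hU
          have h1 : U = U₀ := by rw [eq_of_admissible_zero hU.mem, eq_of_admissible_zero hU₀.mem]
          rw [h1]; exact hU₀
    | succ j =>
        have hM0 : (0 : ℝ) < ((L : ℝ) ^ (j + 1)) ^ 2 := by positivity
        -- p818723 (ii) at radius `ε`: the orbit representative `U♯` and the orbit map
        obtain ⟨Us, -, horbit⟩ := Kb V hVb (j + 1)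
        constructor
        · intro hU
          -- `U` is critical (p818723 (i) at `ε`)
          have hcU := Kc V hVc j U hU
          -- the interior minimiser of the `ε′`-class: critical and `ε`-admissible
          obtain ⟨U', hU'min, a', ha'0, ha'ε, hU'a⟩ := Ka' V hVa' (j + 1)
          have hcU' := tanCritical_of_isMinimiser hL1 hN hU'min ha'0 ha'ε hU'a (hls' j)
          have hU'adm : U' ∈ admissible (sfClass 4 L N ε) L (j + 1) V := admissible_mono_radius hε'ε hU'min.mem
          -- both are gauge copies of `U♯`
          obtain ⟨-, u, hu, -, hg⟩ := horbit U hU.mem (fun j' hj' => by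
            have hjj : j' = j := by omega
            subst hjj; exact hcU)
          obtain ⟨-, u', hu', -, hg'⟩ := horbit U' hU'adm (fun j' hj' => by
            have hjj : j' = j := by omega
            subst hjj; exact hcU')
          -- `U = (U′^{u′})^{u⁻¹}`
          have hUeq : U = gaugeAct (fun z => (u z)⁻¹) (gaugeAct u' U') := by rw [hg', ← hg, gaugeAct_inv_gaugeAct]
          have hS : SmallField U (ε' / ((L : ℝ) ^ (j + 1)) ^ 2) := by
            rw [hUeq]; exact smallField_gaugeAct (isUnitarySite_inv hu) (smallField_gaugeAct hu' hU'min.mem.1.2.2)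
          have hact : levelAction 4 L N (j + 1) U = levelAction 4 L N (j + 1) U' := by
            rw [hUeq, levelAction_gaugeAct, levelAction_gaugeAct]
          refine ⟨⟨⟨hU.mem.1.1, hU.mem.1.2.1, hS⟩, hU.mem.2⟩, fun W hW => ?_⟩
          rw [hact]; exact hU'min.le W hW
        · intro hU
          -- a minimiser of the `ε′`-class is interior there ((8)∀ at `ε′`), hence critical, hence a minimiser of the `ε`-class
          have hUa : SmallField U ((ε' / 4) / ((L : ℝ) ^ (j + 1)) ^ 2) := Kd V hVd (j + 1) U hU
          have haε : (ε' / 4) / ((L : ℝ) ^ (j + 1)) ^ 2 < ε' / ((L : ℝ) ^ (j + 1)) ^ 2 := div_lt_div_of_pos_right (by linarith) hM0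
          have hcU := tanCritical_of_isMinimiser hL1 hN hU (by positivity) haε hUa (hls' j)
          have hUadm : U ∈ admissible (sfClass 4 L N ε) L (j + 1) V := admissible_mono_radius hε'ε hU.mem
          exact (horbit U hUadm (fun j' hj' => by
            have hjj : j' = j := by omega
            subst hjj; exact hcU)).1
  exact ⟨hiff, fun hU => Kd V hVd k U (hiff.1 hU)⟩

end

end Summit.QuantumFields.BalabanUV.T4Continuum.NE7MinimalOrbitClassStable
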